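import Mathlib
import Summits.MatrixMultiplication.MatrixMultiplication.Theses.FourierTwoFamiliesModP
import Summits.MatrixMultiplication.MatrixMultiplication.Theorems.FourierTwoFamiliesModPPrimeTwoFamiliesLadderConverse
import Literature.Computability.AlgebraicComplexity.SimultaneousDoubleProduct

/-!
# The crux gives self-converse gadgets by letter repetition (support file)

Item `stmt-MatrixMultiplication-14308` (`FourierTwoFamiliesModP.PrimeTwoFamilies`, CKSU 2005 Conj. 4.7 with
prime cyclic hosts), line `Sketch` (cycle c1, capacity-gadget skeleton `Cruxes/PrimeTwoFamilies/Lines/Sketch.lean`),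
registered stub `stub_gadgetsOfCrux`.

A *self-converse gadget* of slice `ε` is a list of `r` direct pairs `(P c, Q c)_{c<r}` in `ℤ/m` (letters may
coincide) together with a map `π : Fin r → Fin r` such that every ordered pair of distinct letters `σ ≠ τ` is
strongly separated — every cross difference `q - p`, `p ∈ P σ`, `q ∈ Q τ`, differs from every diagonal
difference `q' - p'`, `p' ∈ P c`, `q' ∈ Q c` — either directly or after applying `π`, with `m^{1-ε} ≤ r`
letters of co-volume `|P c| |Q c| ≥ m^{1-ε}`, for arbitrarily large `m`.

This file shows that the crux `PrimeTwoFamilies` already supplies such gadgets, by LETTER REPETITION: from an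
SDPP witness `(A i, B i)_{i<n}` in `ℤ/p` of the slice `δ = min ε 1` put `m = p`, `r = n²`, index the letters
by pairs `(i, i') ∈ Fin n × Fin n`, and let the letter `(i, i')` carry the pair `(A i, B i)` and `π (i, i') =
(i', i')`.  Directness is clause (W).  For two distinct letters `(i, i') ≠ (k, k')` either `i ≠ k`, and then
clause (X) at `(i, j, k)` (with `j` the first index of the diagonal letter) separates them directly, or `i = k`,
`i' ≠ k'`, and the same argument separates `π (i, i') = (i', i')` from `π (k, k') = (k', k')`.  The exponents
come from `p ≤ n^{2+δ}` and `n^{2-δ} ≤ |A i| |B i| ≤ p` via `LadderLift.ladder_exponents`: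
`p^{1-ε} ≤ n^{2-δ} ≤ n² = r`.  Together with the forward direction of the line (self-converse gadgets give
capacity gadgets give the crux) this makes `SelfConverseGadgets` EQUIVALENT to the crux.
-/

-- single-conjunct summit: the mandated namespace repeats `MatrixMultiplication` (summit = sub-problem).
set_option linter.dupNamespace false

namespace Summit.MatrixMultiplication.MatrixMultiplication.Theorems.PrimeTwoFamilies.CapacityLift

open Finset
open Summit.MatrixMultiplication.MatrixMultiplication.Theses
open Literature.Computability.AlgebraicComplexity

/-- **The crux gives self-converse gadgets (letter repetition).**  Assuming `PrimeTwoFamilies`, for every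
`ε > 0` and `m₀` there are `m ≥ m₀` (a prime), `r` letters `(P c, Q c)` in `ZMod m` and `π : Fin r → Fin r`
with every letter direct, every ordered pair of distinct letters strongly separated either directly or after
`π`, `m^{1-ε} ≤ r`, and co-volumes `m^{1-ε} ≤ |P c| |Q c|`.  Proof: take an SDPP witness `(A i, B i)_{i<n}`
in `ℤ/p` of the slice `δ = min ε 1`, `m = p`, `r = n * n`, and through `e : Fin (n*n) ≃ Fin n × Fin n` let
`P c = A (e c).1`, `Q c = B (e c).1`, `π c = e.symm ((e c).2, (e c).2)`; distinct letters differ in the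
first component (clause (X) separates them) or in the second (clause (X) separates their `π`-images);
`ladder_exponents` gives `p^{1-ε} ≤ n^{2-δ} ≤ |A i| |B i|` and `n^{2-δ} ≤ n² = r`. -/
theorem stub_gadgetsOfCrux (hT : FourierTwoFamiliesModP.PrimeTwoFamilies) :
    ∀ ε : ℝ, 0 < ε → ∀ m₀ : ℕ, ∃ m ≥ m₀, ∃ r : ℕ, ∃ P Q : Fin r → Finset (ZMod m),
      ∃ π : Fin r → Fin r,
      (∀ c : Fin r, ∀ x ∈ P c, ∀ x' ∈ P c, ∀ y ∈ Q c, ∀ y' ∈ Q c,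
          (x - x') + (y - y') = 0 → x = x' ∧ y = y') ∧
      (∀ σ τ : Fin r, σ ≠ τ →
        (∀ p ∈ P σ, ∀ q ∈ Q τ, ∀ c : Fin r, ∀ p' ∈ P c, ∀ q' ∈ Q c, q - p ≠ q' - p') ∨
        (∀ p ∈ P (π σ), ∀ q ∈ Q (π τ), ∀ c : Fin r, ∀ p' ∈ P c, ∀ q' ∈ Q c, q - p ≠ q' - p')) ∧
      (m : ℝ) ^ (1 - ε) ≤ (r : ℝ) ∧
      ∀ c : Fin r, (m : ℝ) ^ (1 - ε) ≤ (((P c).card * (Q c).card : ℕ) : ℝ) := by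
  intro ε hε m₀
  set δ : ℝ := min ε 1
  have hδ : 0 < δ := lt_min hε one_pos
  have hδε : δ ≤ ε := min_le_left _ _
  have hδ1 : δ ≤ 1 := min_le_right _ _
  obtain ⟨n, hn, p, hp, A, B, hW, hX, hpn, hAB⟩ := hT δ hδ (m₀ + 2)
  haveI : Fact p.Prime := ⟨hp⟩
  have hn1 : 1 ≤ n := by omega
  have hn1' : (1 : ℝ) ≤ n := by exact_mod_cast hn1
  -- `m₀ ≤ p`: `m₀ + 2 ≤ n ≤ n^{2-δ} ≤ |A i||B i| ≤ p`
  have i₀ : Fin n := ⟨0, by omega⟩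
  have hABp : (A i₀).card * (B i₀).card ≤ p := by
    have := card_mul_card_le_of_dpp (H := ZMod p) (hW i₀)
    rwa [ZMod.card] at this
  have hm₀ : m₀ ≤ p := by
    have h1 : (n : ℝ) ≤ (n : ℝ) ^ (2 - δ) := by
      calc (n : ℝ) = (n : ℝ) ^ (1 : ℝ) := (Real.rpow_one _).symm
        _ ≤ (n : ℝ) ^ (2 - δ) := Real.rpow_le_rpow_of_exponent_le hn1' (by linarith)
    have h2 : (n : ℝ) ≤ (p : ℝ) := (h1.trans (hAB i₀)).trans (by exact_mod_cast hABp)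
    have h3 : n ≤ p := by exact_mod_cast h2
    omega
  obtain ⟨-, hcov⟩ := LadderLift.ladder_exponents hδ hδε hδ1 hp.one_lt.le hn1 hpn
  -- strong separation of letters with distinct indices, from clause (X) at `(i, j, k)`
  have hsep : ∀ i k : Fin n, i ≠ k → ∀ x ∈ A i, ∀ y ∈ B k, ∀ j : Fin n, ∀ x' ∈ A j, ∀ y' ∈ B j,
      y - x ≠ y' - x' := by
    intro i k hik x hx y hy j x' hx' y' hy' heq
    have h0 : (x - x') + (y' - y) = 0 := by
      rw [show (x - x') + (y' - y) = (y' - x') - (y - x) by abel, heq, sub_self]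
    exact hik (hX i j k x hx x' hx' y' hy' y hy h0)
  -- letter repetition: letters indexed by `Fin n × Fin n`, letter `(i, i')` carries `(A i, B i)`
  have e : Fin (n * n) ≃ Fin n × Fin n := finProdFinEquiv.symm
  refine ⟨p, hm₀, n * n, fun c => A (e c).1, fun c => B (e c).1,
    fun c => e.symm ((e c).2, (e c).2), fun c => hW (e c).1, ?_, ?_,
    fun c => hcov.trans (hAB (e c).1)⟩
  · intro σ τ hστ
    by_cases h1 : (e σ).1 = (e τ).1
    · -- same first index: the second indices differ, separate the `π`-images
      right
      have h2 : (e σ).2 ≠ (e τ).2 := fun h2 => hστ (e.injective (Prod.ext h1 h2))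
      intro x hx y hy c x' hx' y' hy'
      simp only [Equiv.apply_symm_apply] at hx hy
      exact hsep _ _ h2 x hx y hy _ x' hx' y' hy'
    · -- distinct first indices: separate directly
      left
      intro x hx y hy c x' hx' y' hy'
      exact hsep _ _ h1 x hx y hy _ x' hx' y' hy'
  · -- `p^{1-ε} ≤ n^{2-δ} ≤ n² = r`
    calc (p : ℝ) ^ (1 - ε) ≤ (n : ℝ) ^ (2 - δ) := hcov
      _ ≤ (n : ℝ) ^ (2 : ℝ) := Real.rpow_le_rpow_of_exponent_le hn1' (by linarith)
      _ = ((n * n : ℕ) : ℝ) := by rw [Real.rpow_two, sq, Nat.cast_mul]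

end Summit.MatrixMultiplication.MatrixMultiplication.Theorems.PrimeTwoFamilies.CapacityLift
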